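import Summits.QuantumFields.YangMills.Theorems.FluctuationComparisonRegPrIntLS2BetaChartReadCplxAnalytic
import Summits.QuantumFields.YangMills.Theorems.FluctuationComparisonRegPrIntLS2BetaCovWalkSumStokes
import Literature.MathematicalPhysics.QuantumFieldTheory.Balaban1983to89.B12Average05And08
import HarnessLib

/-!
# S2β · (β-3)′ FILE C₃ — GAUGE COVARIANCE OF THE CHART READ AND THE OSCILLATION UNDER A GAUGE CHANGE: the consumer doors (β), (γ) of the curved (β-3)′
# (ARCHITECT px17 g22 2026-08-31T21:38:47Z): `↑ψ_{h•U₀}(Ad_h X)(c) = h(emb c₋)·↑ψ_{U₀}(X)(c)·h(emb c₋)⋆`, the same for `Dψ(0)`, norms and the second-order remainder's norm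
# UNCHANGED; and `‖Ad_g Z − W‖ ≤ ‖Z − W‖ + 2·dist1 g·‖Z‖` (so `OSC(Ad_h X) ≤ OSC(X) + 2·sup‖h − 1‖·M`)

Cell `ym3-torus` (YM ladder rung R3 = continuum `SU(2)` Yang–Mills on the three-torus at fixed lattice data — a RUNG: NOT d = 4, NOT infinite volume, NOT a mass gap,
NOT Clay).  Width seat `ym3-torus-px13` (gen 28); crux `stmt-QuantumFields-20520`, LINE g18-1 S2β, pairing lane; (SCT″-c)₁ source side ∕ (β-3)′.  FILE C₂ (✓p835572
`…ChartReadBkgLipschitz.norm_chartRead_sub_fderiv_le_curved_osc`) prices the order-2 chart remainder at a background `κ`-CLOSE TO `1` on the read region; the tower's backgrounds are only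
GAUGE-EQUIVALENT to such a copy (door (α), the double-block axial gauge, `κ = C·L·θ`).  THIS FILE supplies the two bookkeeping doors that carry the estimate back: (β) the chart read
`ψ_{U₀}(X)(c) = Λ(Ū(Θ^B(X)U₀)(c)·Ū(U₀)(c)⁻¹)` and its derivative at `0` are COVARIANT under `U₀ ↦ h•U₀` (`(h•U₀)(b) = h(b₋)U₀(b)h(b₊)⁻¹`), `X ↦ Ad_h X` (`(Ad_h X)_b = h(b₋)X_b h(b₋)⋆`), by
conjugation with `h(emb c₋)` — hence every NORM in (β-3)′ is gauge invariant; (γ) the reference field moves: `‖Ad_h X − A∘dir‖ ≤ ‖X − A∘dir‖ + 2·sup‖h − 1‖·‖X‖`.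
`--kind proof --supports stmt-QuantumFields-20520 --as helper`, count-neutral, DEFINITION-FREE (0 `def`, 0 `instance`, 0 `notation`, 0 `sorry`, default heartbeats); generic `P : Params`,
`SU(N)`; the conjugated direction is written out as the term `⟨h(b₋)·↑X_b·h(b₋)⋆, conj_mem_lie⟩ : 𝔰𝔲(N)`.

THE ROAD (all landed tools).  `𝔰𝔲(N)` is `Ad`-invariant (`star`, `trace` cyclic); `Θ(gXg⋆) = gΘ(X)g⁻¹` (Mathlib `exp_units_conj`); so `Θ^B(Ad_h X)·(h•U₀) = h•(Θ^B(X)·U₀)` bondwise;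
lit ✓`avgFun_covariant` ([Balaban1985Averaging] (11)) twice gives `Ū(h•V)(c)·Ū(h•U₀)(c)⁻¹ = h₀·[Ū(V)(c)Ū(U₀)(c)⁻¹]·h₀⁻¹`, `h₀ = h(emb c₋)`; on the log window `Λ(h₀Wh₀⁻¹) = Ad_{h₀}Λ(W)`
(lit ✓`B12Average05And08.mlog_conj_units`, the window being `Ad`-invariant).  For the derivative: `Ad_h(tX) = t·Ad_h X`, the window holds near `t = 0` ((β-2) ✓`norm_coe_relAvg_sub_one_le`),
the ray derivatives exist at `U₀` and at `h•U₀` (✓`hasDerivAt_chartRead_avgFun_ray`; the loop guard is gauge invariant, lit ✓`loopHol_gaugeAct`), and derivatives of eventually equal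
curves agree.

WHAT IS PROVED (sorry-free).
§1 `conj_mem_lie`, ★`expChart_conj` (`Θ(gXg⋆) = g·Θ(X)·g⁻¹`), `conj_smul`, ★`norm_conj_sub_le` (**door (γ)**: `‖gZg⋆ − W‖ ≤ ‖Z − W‖ + 2·dist1 g·‖Z‖`), ★`norm_conjField_sub_le` (its bond-field
   Pi-sup form with `dist1 (h x) ≤ κ`: `‖Ad_h Z − W‖ ≤ ‖Z − W‖ + 2κ‖Z‖`).
§2 `piExpChart_translate_gaugeAct`, ★`relAvg_gaugeAct` (standing range), ★`coe_logChart_conj`, ★★★**`coe_chartRead_gaugeAct`** (**door (β)**, hypothesis: the relative average of `U₀, X` at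
   `c` is in the log window), ★`norm_coe_chartRead_gaugeAct` (norms equal).
§3 `dist1_loopHol_gaugeAct` (guard invariant), ★★★**`coe_fderiv_chartRead_gaugeAct`** (**door (β′)**: hyps of (β-2)∕(β-3) — `0 < ρ ≤ innerRadius`, guard `∀ c i, dist1 (loopHol U₀ c i) ≤ α`,
   `4α ≤ ρ`, standing range), ★`norm_coe_fderiv_chartRead_gaugeAct`, ★★`norm_chartRead_sub_fderiv_gaugeAct` (**the second-order remainder's norm is gauge invariant** on the polydisc
   `100ℓ(e^{‖X‖} − 1) ≤ ρ`) — so C₂'s curved (β-3)′, proved in the gauge copy where `‖U₀ − 1‖ ≤ κ` on `B(c₋) ∪ B(c₊)`, bounds the remainder of the ORIGINAL pair `(U₀, X)` verbatim, with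
   `OSC` read through (γ).
NOT HERE (door (α)): the axial-gauge construction producing `h` with `‖(h•U₀)(b) − 1‖ ≤ C·L·θ` on the block pair and `sup‖h − 1‖ ≤ 2σ + C·L·θ` (architect 21:38:47Z).

HONEST.  Group∕chart bookkeeping over landed engines; nothing of Bałaban's analysis is asserted or proved ([Balaban1985Averaging] (8), (11)–(13), (21)–(23), Prop. 3 (121)–(123) are
cited as the SOURCES of the objects); (α), OSC-lift docking, rows' `R`∕`ε`, budgets, (E5), (ST‴), (SCT″-c)₁₂₃, LOC‴, GAP♯∘ (`stub_uniformFibreGapOrbit`, registry 3732b7df UNTOUCHED, 0∕5),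
the five REGISTERED stubs, S2β, crux 20520, 19936, 19200, `YM3TorusSU2` — NOT proved; no summit statement is proved by a helper; rung R3 = SU(2) YM₃ on T³ at fixed lattice data — NOT
d = 4, NOT infinite volume, NOT a mass gap, NOT Clay; the Yang–Mills mass gap is NOT proved.  Axioms standard.

References: [Balaban1985Averaging] T. Bałaban, CMP **98** (1985) 17–51, (8), (11)–(13) pp.18–19, (21)–(23) p.21, Prop. 3 (121)–(123) p.36; [Balaban1987RG1] CMP **109** (1987) 249–301,
(0.4), (0.6) p.253; [Helgason2000] S. Helgason, Differential Geometry, Lie Groups, and Symmetric Spaces, Ch. I §1 Thm. 1.14.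
-/

set_option autoImplicit false

noncomputable section

open scoped Matrix.Norms.L2Operator Topology
open Filter Set Function Metric

namespace Summit.QuantumFields.YangMills.Theorems.FluctuationComparisonRegPrIntLS2BetaChartReadGaugeCovariance

open Literature.MathematicalPhysics.QuantumFieldTheory.Balaban1983to89
open Literature.MathematicalPhysics.QuantumFieldTheory.Balaban1983to89.HaarExponentialChart
open Literature.MathematicalPhysics.QuantumFieldTheory.Balaban1983to89.HaarExponentialChart.IsChartRep
open Literature.MathematicalPhysics.QuantumFieldTheory.Balaban1983to89.BlockAveraging (Small Idx avgFun loopHol off corr avgFun_covariant loopHol_gaugeAct)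
open Literature.MathematicalPhysics.QuantumFieldTheory.Balaban1983to89.ExpMeanLog (eml expMeanLogSU deltaSU deltaSU_pos)
open Literature.MathematicalPhysics.QuantumFieldTheory.Balaban1983to89.Node00
open Literature.MathematicalPhysics.QuantumFieldTheory.Balaban1983to89.T4Continuum (walk holAt LStep loopWord)
open Literature.MathematicalPhysics.QuantumLattice (fundamentalRep fundamentalRep_apply)
open MatrixLog (mlog)
open Summit.QuantumFields.YangMills.BalabanUVNodes.N09ChartReadAveragingSmooth
open Summit.QuantumFields.YangMills.BalabanUVNodes.N09CentralWindowInjective (norm_coe_SU_le_one)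
open Summit.QuantumFields.YangMills.Theorems.FluctuationComparisonRegPrIntLS2BetaChartReadCplxExtension
open Summit.QuantumFields.YangMills.Theorems.FluctuationComparisonRegPrIntLS2BetaChartReadCplxAnalytic
open Summit.QuantumFields.YangMills.Theorems.FluctuationComparisonRegPrIntLS2BetaCovWalkSumStokes (norm_coe_conj_le norm_conj_sub_self_le)
open Summit.QuantumFields.YangMills.Theorems.FluctuationComparisonRegPrIntLS2BetaChartReadDescentChainRule (hasDerivAt_chartRead_avgFun_ray)

variable {P : Params} {j : ℕ} {N : ℕ} [NeZero N]

/-! ## §1 `Ad_g` on `𝔰𝔲(N)` and on the chart; the oscillation under conjugation (door (γ)) -/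

section Algebra

/-- `𝔰𝔲(N)` is `Ad`-invariant: `g X g⋆` is skew-adjoint and traceless for `g ∈ SU(N)`, `X ∈ 𝔰𝔲(N)`. [folklore] -/
theorem conj_mem_lie (g : SU N) (X : (specialUnitaryLogChart (Fin N)).lie) :
    ((g : SU N) : Matrix (Fin N) (Fin N) ℂ) * ((X : (specialUnitaryLogChart (Fin N)).lie) : Matrix (Fin N) (Fin N) ℂ) * star ((g : SU N) : Matrix (Fin N) (Fin N) ℂ) ∈ (specialUnitaryLogChart (Fin N)).lie := by
  have hX := mem_specialUnitaryLogChart_lie.1 X.2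
  refine mem_specialUnitaryLogChart_lie.2 ⟨?_, ?_⟩
  · rw [star_mul, star_mul, star_star, hX.1]; noncomm_ring
  · rw [Matrix.trace_mul_cycle, mul_assoc, star_coe_mul_coe_mul_SU, hX.2]

/-- **THE CHART IS `Ad`-EQUIVARIANT**: `Θ(g X g⋆) = g·Θ(X)·g⁻¹` (`e^{gXg⋆} = g e^X g⋆`, Mathlib `exp_units_conj`). [cite: Helgason2000, Ch. I §1 Thm. 1.14 (13) p. 96 (bookkeeping)] -/
theorem expChart_conj (g : SU N) (X : (specialUnitaryLogChart (Fin N)).lie) :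
    (isChartRep_specialUnitaryGroup (n := Fin N)).expChart (⟨((g : SU N) : Matrix (Fin N) (Fin N) ℂ) * ((X : (specialUnitaryLogChart (Fin N)).lie) : Matrix (Fin N) (Fin N) ℂ) * star ((g : SU N) : Matrix (Fin N) (Fin N) ℂ), conj_mem_lie g X⟩ : (specialUnitaryLogChart (Fin N)).lie) =
      g * (isChartRep_specialUnitaryGroup (n := Fin N)).expChart X * g⁻¹ := by
  apply Subtype.ext
  rw [BalabanUVNodes.N09ChartReadAveragingSmooth.coe_expChart, Submonoid.coe_mul, Submonoid.coe_mul,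
    BalabanUVNodes.N09ChartReadAveragingSmooth.coe_expChart, coe_inv_SU]
  letI : NormedAlgebra ℚ (Matrix (Fin N) (Fin N) ℂ) := NormedAlgebra.restrictScalars ℚ ℂ (Matrix (Fin N) (Fin N) ℂ)
  exact NormedSpace.exp_units_conj ⟨((g : SU N) : Matrix (Fin N) (Fin N) ℂ), star ((g : SU N) : Matrix (Fin N) (Fin N) ℂ), coe_mul_star_coe_SU g, star_coe_mul_coe_SU g⟩ _

/-- `Ad_g` commutes with real scalars on `𝔰𝔲(N)`: `(t•X)^g = t•X^g`. [folklore] -/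
theorem conj_smul (g : SU N) (t : ℝ) (X : (specialUnitaryLogChart (Fin N)).lie) :
    (⟨((g : SU N) : Matrix (Fin N) (Fin N) ℂ) * (((t • X : (specialUnitaryLogChart (Fin N)).lie) : (specialUnitaryLogChart (Fin N)).lie) : Matrix (Fin N) (Fin N) ℂ) * star ((g : SU N) : Matrix (Fin N) (Fin N) ℂ), conj_mem_lie g (t • X)⟩ : (specialUnitaryLogChart (Fin N)).lie) =
      t • (⟨((g : SU N) : Matrix (Fin N) (Fin N) ℂ) * ((X : (specialUnitaryLogChart (Fin N)).lie) : Matrix (Fin N) (Fin N) ℂ) * star ((g : SU N) : Matrix (Fin N) (Fin N) ℂ), conj_mem_lie g X⟩ : (specialUnitaryLogChart (Fin N)).lie) := by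
  apply Subtype.ext
  simp only [Submodule.coe_smul, mul_smul_comm, smul_mul_assoc]

/-- ★ **DOOR (γ) — THE OSCILLATION UNDER A CONJUGATION**: `‖g Z g⋆ − W‖ ≤ ‖Z − W‖ + 2·dist1 g·‖Z‖` (✓`norm_conj_sub_self_le`: `‖gZg⋆ − Z‖ ≤ 2·dist1 g·‖Z‖`). [folklore] -/
theorem norm_conj_sub_le (g : SU N) (Z W : Matrix (Fin N) (Fin N) ℂ) :
    ‖((g : SU N) : Matrix (Fin N) (Fin N) ℂ) * Z * star ((g : SU N) : Matrix (Fin N) (Fin N) ℂ) - W‖ ≤ ‖Z - W‖ + 2 * dist1 g * ‖Z‖ := by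
  have e : ((g : SU N) : Matrix (Fin N) (Fin N) ℂ) * Z * star ((g : SU N) : Matrix (Fin N) (Fin N) ℂ) - W = (Z - W) + (((g : SU N) : Matrix (Fin N) (Fin N) ℂ) * Z * star ((g : SU N) : Matrix (Fin N) (Fin N) ℂ) - Z) := by abel
  rw [e]
  exact (norm_add_le _ _).trans (add_le_add le_rfl (norm_conj_sub_self_le g Z))

/-- ★ **DOOR (γ), BOND-FIELD FORM**: for a gauge transformation `h` with `dist1 (h x) ≤ κ` at every site and bond matrix fields `Z, W`:
`‖(b ↦ h(b₋) Z_b h(b₋)⋆) − W‖ ≤ ‖Z − W‖ + 2κ·‖Z‖` — `OSC(Ad_h X) ≤ OSC(X) + 2·sup‖h − 1‖·M` in the (β-3)′ Pi-sup currency. [folklore] -/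
theorem norm_conjField_sub_le (h : GaugeTransf P j (SU N)) {κ : ℝ} (hκ0 : 0 ≤ κ) (hκ : ∀ x : Site P j, dist1 (h x) ≤ κ)
    (Z W : PBond P j → Matrix (Fin N) (Fin N) ℂ) :
    ‖(fun b : PBond P j => ((h b.src : SU N) : Matrix (Fin N) (Fin N) ℂ) * Z b * star ((h b.src : SU N) : Matrix (Fin N) (Fin N) ℂ)) - W‖ ≤ ‖Z - W‖ + 2 * κ * ‖Z‖ := by
  refine (pi_norm_le_iff_of_nonneg (by positivity)).2 fun b => ?_
  rw [Pi.sub_apply]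
  calc _ ≤ ‖Z b - W b‖ + 2 * dist1 (h b.src) * ‖Z b‖ := norm_conj_sub_le (h b.src) (Z b) (W b)
    _ ≤ ‖Z - W‖ + 2 * κ * ‖Z‖ := by
        have h1 : ‖Z b - W b‖ ≤ ‖Z - W‖ := by rw [← Pi.sub_apply]; exact norm_le_pi_norm (Z - W) b
        have h2 : ‖Z b‖ ≤ ‖Z‖ := norm_le_pi_norm Z b
        have h3 : 0 ≤ dist1 (h b.src) := GaugeGroup.dist1_nonneg _
        nlinarith [hκ b.src, norm_nonneg (Z b)]

end Algebra

/-! ## §2 ★★★ Door (β): the chart read is gauge COVARIANT — `ψ_{h•U₀}(Ad_h X)(c) = Ad_{h(emb c₋)} ψ_{U₀}(X)(c)` -/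

section Covariance

variable (h : GaugeTransf P j (SU N)) (U₀ : GaugeField P j (SU N))

/-- The charted translate of the conjugated direction at the transformed background IS the gauge transform of the charted translate:
`Θ((Ad_h X)_b)·(h•U₀)(b) = h(b₋)·Θ(X_b)U₀(b)·h(b₊)⁻¹`. [cite: Balaban1985Averaging, (8), (11) p.18-19] -/
theorem piExpChart_translate_gaugeAct (X : PBond P j → (specialUnitaryLogChart (Fin N)).lie) :
    (fun b : PBond P j => (isChartRep_specialUnitaryGroup (n := Fin N)).expChart ((fun b : PBond P j => (⟨((h b.src : SU N) : Matrix (Fin N) (Fin N) ℂ) * ((X b : (specialUnitaryLogChart (Fin N)).lie) : Matrix (Fin N) (Fin N) ℂ) * star ((h b.src : SU N) : Matrix (Fin N) (Fin N) ℂ), conj_mem_lie (h b.src) (X b)⟩ : (specialUnitaryLogChart (Fin N)).lie)) b) * (GaugeField.gaugeAct h U₀) b) =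
      GaugeField.gaugeAct h (fun b => (isChartRep_specialUnitaryGroup (n := Fin N)).expChart (X b) * U₀ b) := by
  funext b
  show (isChartRep_specialUnitaryGroup (n := Fin N)).expChart (⟨((h b.src : SU N) : Matrix (Fin N) (Fin N) ℂ) * ((X b : (specialUnitaryLogChart (Fin N)).lie) : Matrix (Fin N) (Fin N) ℂ) * star ((h b.src : SU N) : Matrix (Fin N) (Fin N) ℂ), conj_mem_lie (h b.src) (X b)⟩ : (specialUnitaryLogChart (Fin N)).lie) *
      (h b.src * U₀ b * (h b.tgt)⁻¹) = h b.src * ((isChartRep_specialUnitaryGroup (n := Fin N)).expChart (X b) * U₀ b) * (h b.tgt)⁻¹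
  rw [expChart_conj]
  group

/-- **THE RELATIVE AVERAGE IS CONJUGATED BY `h(emb c₋)`** (lit ✓`avgFun_covariant` twice; the `h(emb c₊)` factors cancel). [cite: Balaban1985Averaging, (11) p.19; Balaban1987RG1, (0.6) p.253] -/
theorem relAvg_gaugeAct (hj : j + 1 ≤ P.m + P.K) (X : PBond P j → (specialUnitaryLogChart (Fin N)).lie) (c : PBond P (j + 1)) :
    avgFun (expMeanLogSU (n := Fin N)) (fun b : PBond P j => (isChartRep_specialUnitaryGroup (n := Fin N)).expChart ((fun b : PBond P j => (⟨((h b.src : SU N) : Matrix (Fin N) (Fin N) ℂ) * ((X b : (specialUnitaryLogChart (Fin N)).lie) : Matrix (Fin N) (Fin N) ℂ) * star ((h b.src : SU N) : Matrix (Fin N) (Fin N) ℂ), conj_mem_lie (h b.src) (X b)⟩ : (specialUnitaryLogChart (Fin N)).lie)) b) * (GaugeField.gaugeAct h U₀) b) c *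
        (avgFun (expMeanLogSU (n := Fin N)) (GaugeField.gaugeAct h U₀) c)⁻¹ =
      h (emb c.src) * (avgFun (expMeanLogSU (n := Fin N)) (fun b => (isChartRep_specialUnitaryGroup (n := Fin N)).expChart (X b) * U₀ b) c *
        (avgFun (expMeanLogSU (n := Fin N)) U₀ c)⁻¹) * (h (emb c.src))⁻¹ := by
  rw [piExpChart_translate_gaugeAct, avgFun_covariant _ hj, avgFun_covariant _ hj]
  show h (emb c.src) * avgFun (expMeanLogSU (n := Fin N)) (fun b => (isChartRep_specialUnitaryGroup (n := Fin N)).expChart (X b) * U₀ b) c * (h (emb c.tgt))⁻¹ *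
      (h (emb c.src) * avgFun (expMeanLogSU (n := Fin N)) U₀ c * (h (emb c.tgt))⁻¹)⁻¹ = _
  group

/-- The matrix of a conjugated chart reading: `↑Λ(g W g⁻¹) = g·↑Λ(W)·g⋆` on the log window (lit `coe_logChart`, `B12Average05And08.mlog_conj_units`; the window is `Ad`-invariant).
[cite: Balaban1985Averaging, (21)-(23) p.21] -/
theorem coe_logChart_conj (g W : SU N) (hW : ‖(W : Matrix (Fin N) (Fin N) ℂ) - 1‖ < innerRadius (specialUnitaryLogChart (Fin N))) :
    (((isChartRep_specialUnitaryGroup (n := Fin N)).logChart (g * W * g⁻¹) : (specialUnitaryLogChart (Fin N)).lie) : Matrix (Fin N) (Fin N) ℂ) =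
      ((g : SU N) : Matrix (Fin N) (Fin N) ℂ) * (((isChartRep_specialUnitaryGroup (n := Fin N)).logChart W : (specialUnitaryLogChart (Fin N)).lie) : Matrix (Fin N) (Fin N) ℂ) * star ((g : SU N) : Matrix (Fin N) (Fin N) ℂ) := by
  have hcoe : (((g * W * g⁻¹ : SU N)) : Matrix (Fin N) (Fin N) ℂ) = ((g : SU N) : Matrix (Fin N) (Fin N) ℂ) * (W : Matrix (Fin N) (Fin N) ℂ) * star ((g : SU N) : Matrix (Fin N) (Fin N) ℂ) := by
    rw [Submonoid.coe_mul, Submonoid.coe_mul, coe_inv_SU]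
  have hsub : ((g : SU N) : Matrix (Fin N) (Fin N) ℂ) * (W : Matrix (Fin N) (Fin N) ℂ) * star ((g : SU N) : Matrix (Fin N) (Fin N) ℂ) - 1 = ((g : SU N) : Matrix (Fin N) (Fin N) ℂ) * ((W : Matrix (Fin N) (Fin N) ℂ) - 1) * star ((g : SU N) : Matrix (Fin N) (Fin N) ℂ) := by
    rw [mul_sub, sub_mul, mul_one, coe_mul_star_coe_SU]
  have hW' : ‖(((g * W * g⁻¹ : SU N)) : Matrix (Fin N) (Fin N) ℂ) - 1‖ < innerRadius (specialUnitaryLogChart (Fin N)) := by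
    rw [hcoe, hsub]; exact (norm_coe_conj_le g _).trans_lt hW
  have h1 : innerRadius (specialUnitaryLogChart (Fin N)) ≤ 1 := innerRadius_le_third.trans (by norm_num)
  rw [(isChartRep_specialUnitaryGroup (n := Fin N)).coe_logChart (by rwa [fundamentalRep_apply]),
    (isChartRep_specialUnitaryGroup (n := Fin N)).coe_logChart (by rwa [fundamentalRep_apply]), fundamentalRep_apply, fundamentalRep_apply, hcoe]
  set Pu : (Matrix (Fin N) (Fin N) ℂ)ˣ := ⟨((g : SU N) : Matrix (Fin N) (Fin N) ℂ), star ((g : SU N) : Matrix (Fin N) (Fin N) ℂ), coe_mul_star_coe_SU g, star_coe_mul_coe_SU g⟩ with hPu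
  have hP : ((Pu : (Matrix (Fin N) (Fin N) ℂ)ˣ) : Matrix (Fin N) (Fin N) ℂ) = ((g : SU N) : Matrix (Fin N) (Fin N) ℂ) := rfl
  have hPi : ((Pu⁻¹ : (Matrix (Fin N) (Fin N) ℂ)ˣ) : Matrix (Fin N) (Fin N) ℂ) = star ((g : SU N) : Matrix (Fin N) (Fin N) ℂ) := rfl
  have hZ : ‖(W : Matrix (Fin N) (Fin N) ℂ) - 1‖ < 1 := hW.trans_le h1
  have hPZ : ‖(Pu : Matrix (Fin N) (Fin N) ℂ) * (W : Matrix (Fin N) (Fin N) ℂ) * ((Pu⁻¹ : (Matrix (Fin N) (Fin N) ℂ)ˣ) : Matrix (Fin N) (Fin N) ℂ) - 1‖ < 1 := by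
    rw [hP, hPi, hsub]; exact (norm_coe_conj_le g _).trans_lt hZ
  have hm := B12Average05And08.mlog_conj_units (P := Pu) hZ hPZ
  rw [hP, hPi] at hm
  exact hm

/-- ★★★ **DOOR (β) — THE CHART READ IS GAUGE COVARIANT**: for a gauge transformation `h`, in the standing range, whenever the relative average `Ū(Θ^B(X)U₀)(c)·Ū(U₀)(c)⁻¹` is in the
log window: `↑(ψ_{h•U₀}(Ad_h X)(c)) = h(emb c₋)·↑(ψ_{U₀}(X)(c))·h(emb c₋)⋆` with `(Ad_h X)_b = h(b₋) X_b h(b₋)⋆` and `(h•U₀)(b) = h(b₋)U₀(b)h(b₊)⁻¹`.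
[cite: Balaban1985Averaging, (11)-(13) p.19, Prop. 3 (121) p.36; Balaban1987RG1, (0.6) p.253] -/
theorem coe_chartRead_gaugeAct (hj : j + 1 ≤ P.m + P.K) (X : PBond P j → (specialUnitaryLogChart (Fin N)).lie) (c : PBond P (j + 1))
    (hwin : ‖((avgFun (expMeanLogSU (n := Fin N)) (fun b => (isChartRep_specialUnitaryGroup (n := Fin N)).expChart (X b) * U₀ b) c *
        (avgFun (expMeanLogSU (n := Fin N)) U₀ c)⁻¹ : SU N) : Matrix (Fin N) (Fin N) ℂ) - 1‖ < innerRadius (specialUnitaryLogChart (Fin N))) :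
    ((((isChartRep_specialUnitaryGroup (n := Fin N)).logChart (avgFun (expMeanLogSU (n := Fin N)) (fun b => (isChartRep_specialUnitaryGroup (n := Fin N)).expChart ((fun b : PBond P j => (⟨((h b.src : SU N) : Matrix (Fin N) (Fin N) ℂ) * ((X b : (specialUnitaryLogChart (Fin N)).lie) : Matrix (Fin N) (Fin N) ℂ) * star ((h b.src : SU N) : Matrix (Fin N) (Fin N) ℂ), conj_mem_lie (h b.src) (X b)⟩ : (specialUnitaryLogChart (Fin N)).lie)) b) * (GaugeField.gaugeAct h U₀) b) c * (avgFun (expMeanLogSU (n := Fin N)) (GaugeField.gaugeAct h U₀) c)⁻¹)) : (specialUnitaryLogChart (Fin N)).lie) : Matrix (Fin N) (Fin N) ℂ) =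
      ((h (emb c.src) : SU N) : Matrix (Fin N) (Fin N) ℂ) * ((((isChartRep_specialUnitaryGroup (n := Fin N)).logChart (avgFun (expMeanLogSU (n := Fin N)) (fun b => (isChartRep_specialUnitaryGroup (n := Fin N)).expChart (X b) * U₀ b) c * (avgFun (expMeanLogSU (n := Fin N)) U₀ c)⁻¹)) : (specialUnitaryLogChart (Fin N)).lie) : Matrix (Fin N) (Fin N) ℂ) * star ((h (emb c.src) : SU N) : Matrix (Fin N) (Fin N) ℂ) := by
  rw [relAvg_gaugeAct h U₀ hj X c]
  exact coe_logChart_conj (h (emb c.src)) _ hwin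

/-- ★ **NORMS ARE GAUGE INVARIANT**: `‖↑(ψ_{h•U₀}(Ad_h X)(c))‖ = ‖↑(ψ_{U₀}(X)(c))‖` (unitary conjugation is isometric). [cite: Balaban1985Averaging, (12)-(13) p.19] -/
theorem norm_coe_chartRead_gaugeAct (hj : j + 1 ≤ P.m + P.K) (X : PBond P j → (specialUnitaryLogChart (Fin N)).lie) (c : PBond P (j + 1))
    (hwin : ‖((avgFun (expMeanLogSU (n := Fin N)) (fun b => (isChartRep_specialUnitaryGroup (n := Fin N)).expChart (X b) * U₀ b) c *
        (avgFun (expMeanLogSU (n := Fin N)) U₀ c)⁻¹ : SU N) : Matrix (Fin N) (Fin N) ℂ) - 1‖ < innerRadius (specialUnitaryLogChart (Fin N))) :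
    ‖((((isChartRep_specialUnitaryGroup (n := Fin N)).logChart (avgFun (expMeanLogSU (n := Fin N)) (fun b => (isChartRep_specialUnitaryGroup (n := Fin N)).expChart ((fun b : PBond P j => (⟨((h b.src : SU N) : Matrix (Fin N) (Fin N) ℂ) * ((X b : (specialUnitaryLogChart (Fin N)).lie) : Matrix (Fin N) (Fin N) ℂ) * star ((h b.src : SU N) : Matrix (Fin N) (Fin N) ℂ), conj_mem_lie (h b.src) (X b)⟩ : (specialUnitaryLogChart (Fin N)).lie)) b) * (GaugeField.gaugeAct h U₀) b) c * (avgFun (expMeanLogSU (n := Fin N)) (GaugeField.gaugeAct h U₀) c)⁻¹)) : (specialUnitaryLogChart (Fin N)).lie) : Matrix (Fin N) (Fin N) ℂ)‖ = ‖((((isChartRep_specialUnitaryGroup (n := Fin N)).logChart (avgFun (expMeanLogSU (n := Fin N)) (fun b => (isChartRep_specialUnitaryGroup (n := Fin N)).expChart (X b) * U₀ b) c * (avgFun (expMeanLogSU (n := Fin N)) U₀ c)⁻¹)) : (specialUnitaryLogChart (Fin N)).lie) : Matrix (Fin N) (Fin N) ℂ)‖ := by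
  rw [coe_chartRead_gaugeAct h U₀ hj X c hwin]
  refine le_antisymm (norm_coe_conj_le _ _) ?_
  set H : Matrix (Fin N) (Fin N) ℂ := ((h (emb c.src) : SU N) : Matrix (Fin N) (Fin N) ℂ) with hH
  set Y : Matrix (Fin N) (Fin N) ℂ := ((((isChartRep_specialUnitaryGroup (n := Fin N)).logChart (avgFun (expMeanLogSU (n := Fin N)) (fun b => (isChartRep_specialUnitaryGroup (n := Fin N)).expChart (X b) * U₀ b) c * (avgFun (expMeanLogSU (n := Fin N)) U₀ c)⁻¹)) : (specialUnitaryLogChart (Fin N)).lie) : Matrix (Fin N) (Fin N) ℂ) with hY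
  have hstar : star H * H = 1 := by
    have e1 := star_coe_mul_coe_mul_SU (h (emb c.src)) (1 : Matrix (Fin N) (Fin N) ℂ); rwa [mul_one] at e1
  have e : (((h (emb c.src))⁻¹ : SU N) : Matrix (Fin N) (Fin N) ℂ) * (H * Y * star H) * star (((h (emb c.src))⁻¹ : SU N) : Matrix (Fin N) (Fin N) ℂ) = Y := by
    rw [coe_inv_SU, star_star]
    calc star H * (H * Y * star H) * H = (star H * H) * Y * (star H * H) := by noncomm_ring
      _ = Y := by rw [hstar, one_mul, mul_one]
  calc ‖Y‖ = ‖(((h (emb c.src))⁻¹ : SU N) : Matrix (Fin N) (Fin N) ℂ) * (H * Y * star H) * star (((h (emb c.src))⁻¹ : SU N) : Matrix (Fin N) (Fin N) ℂ)‖ := by rw [e]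
    _ ≤ ‖H * Y * star H‖ := norm_coe_conj_le _ _

end Covariance

/-! ## §3 ★★★ Door (β′): the DERIVATIVE of the chart read is gauge covariant -/

section Deriv

variable (h : GaugeTransf P j (SU N)) (U₀ : GaugeField P j (SU N))

/-- The loop guard is gauge invariant (lit ✓`loopHol_gaugeAct`, `dist1_conj`). [cite: Balaban1985Averaging, (12)-(13) p.19] -/
theorem dist1_loopHol_gaugeAct (c : PBond P (j + 1)) (i : Idx P) :
    dist1 (loopHol (GaugeField.gaugeAct h U₀) c i) = dist1 (loopHol U₀ c i) := by
  rw [loopHol_gaugeAct, GaugeGroup.dist1_conj]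

/-- Along the ray: `↑ψ_{h•U₀}(t·Ad_h X)(c) = h(emb c₋)·↑ψ_{U₀}(tX)(c)·h(emb c₋)⋆` for `t` near `0` (`Ad_h(tX) = t·Ad_h X`; the log window holds near `0` by (β-2)
✓`norm_coe_relAvg_sub_one_le` under the guard). [cite: Balaban1985Averaging, (11)-(13) p.19, Prop. 3 (121) p.36] -/
theorem coe_chartRead_ray_gaugeAct_eventuallyEq (hj : j + 1 ≤ P.m + P.K) {α ρ : ℝ} (hρ0 : 0 < ρ) (hρ : ρ ≤ innerRadius (specialUnitaryLogChart (Fin N)))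
    (hα : ∀ c i, dist1 (loopHol U₀ c i) ≤ α) (hα4 : 4 * α ≤ ρ) (X : PBond P j → (specialUnitaryLogChart (Fin N)).lie) (c : PBond P (j + 1)) :
    (fun t : ℝ => (((fun (A : PBond P j → (specialUnitaryLogChart (Fin N)).lie) (c : PBond P (j + 1)) => (isChartRep_specialUnitaryGroup (n := Fin N)).logChart (avgFun (expMeanLogSU (n := Fin N)) (fun b => (isChartRep_specialUnitaryGroup (n := Fin N)).expChart (A b) * (GaugeField.gaugeAct h U₀) b) c * (avgFun (expMeanLogSU (n := Fin N)) (GaugeField.gaugeAct h U₀) c)⁻¹)) (t • (fun b : PBond P j => (⟨((h b.src : SU N) : Matrix (Fin N) (Fin N) ℂ) * ((X b : (specialUnitaryLogChart (Fin N)).lie) : Matrix (Fin N) (Fin N) ℂ) * star ((h b.src : SU N) : Matrix (Fin N) (Fin N) ℂ), conj_mem_lie (h b.src) (X b)⟩ : (specialUnitaryLogChart (Fin N)).lie))) c : (specialUnitaryLogChart (Fin N)).lie) : Matrix (Fin N) (Fin N) ℂ)) =ᶠ[𝓝 0]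
      fun t : ℝ => ((h (emb c.src) : SU N) : Matrix (Fin N) (Fin N) ℂ) * (((fun (A : PBond P j → (specialUnitaryLogChart (Fin N)).lie) (c : PBond P (j + 1)) => (isChartRep_specialUnitaryGroup (n := Fin N)).logChart (avgFun (expMeanLogSU (n := Fin N)) (fun b => (isChartRep_specialUnitaryGroup (n := Fin N)).expChart (A b) * U₀ b) c * (avgFun (expMeanLogSU (n := Fin N)) U₀ c)⁻¹)) (t • X) c : (specialUnitaryLogChart (Fin N)).lie) : Matrix (Fin N) (Fin N) ℂ) * star ((h (emb c.src) : SU N) : Matrix (Fin N) (Fin N) ℂ) := by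
  have hℓ1 : (1 : ℝ) ≤ (((P.d + 2) * P.L : ℕ) : ℝ) := by exact_mod_cast Nat.one_le_iff_ne_zero.2 (Nat.mul_ne_zero (by omega) P.L_pos.ne')
  have hρ3 : ρ ≤ 1 / 3 := hρ.trans innerRadius_le_third
  -- `Ad_h (t•X) = t • Ad_h X`
  have hsm : ∀ t : ℝ, t • (fun b : PBond P j => (⟨((h b.src : SU N) : Matrix (Fin N) (Fin N) ℂ) * ((X b : (specialUnitaryLogChart (Fin N)).lie) : Matrix (Fin N) (Fin N) ℂ) * star ((h b.src : SU N) : Matrix (Fin N) (Fin N) ℂ), conj_mem_lie (h b.src) (X b)⟩ : (specialUnitaryLogChart (Fin N)).lie)) = (fun b : PBond P j => (⟨((h b.src : SU N) : Matrix (Fin N) (Fin N) ℂ) * (((t • X) b : (specialUnitaryLogChart (Fin N)).lie) : Matrix (Fin N) (Fin N) ℂ) * star ((h b.src : SU N) : Matrix (Fin N) (Fin N) ℂ), conj_mem_lie (h b.src) ((t • X) b)⟩ : (specialUnitaryLogChart (Fin N)).lie)) := by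
    intro t; funext b
    rw [Pi.smul_apply]
    exact (conj_smul (h b.src) t (X b)).symm
  -- the window near `t = 0`
  set a : ℝ := ρ / (200 * (((P.d + 2) * P.L : ℕ) : ℝ)) with ha
  have ha0 : 0 < a := by rw [ha]; positivity
  have ha1 : a ≤ 1 := by rw [ha, div_le_one (by positivity)]; linarith
  have hℓ2a : (((P.d + 2) * P.L : ℕ) : ℝ) * (2 * a) = ρ / 100 := by
    rw [ha]; field_simp; ring
  have htend : Tendsto (fun t : ℝ => t • X) (𝓝 0) (𝓝 0) := by
    have hc : Continuous (fun t : ℝ => t • X) := continuous_id.smul continuous_const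
    simpa using hc.tendsto 0
  filter_upwards [htend (Metric.ball_mem_nhds 0 ha0)] with t ht
  have hY : ‖t • X‖ < a := mem_ball_zero_iff.1 ht
  have hm : Real.exp ‖t • X‖ - 1 ≤ 2 * a := by
    have hea : Real.exp a - 1 ≤ 2 * a := by
      have h3 := Real.abs_exp_sub_one_sub_id_le (x := a) (by rw [abs_of_nonneg ha0.le]; exact ha1)
      have h4 : Real.exp a - 1 - a ≤ a ^ 2 := (le_abs_self _).trans h3
      nlinarith
    linarith [Real.exp_le_exp.2 hY.le]
  have hm' : (((P.d + 2) * P.L : ℕ) : ℝ) * (Real.exp ‖t • X‖ - 1) ≤ (((P.d + 2) * P.L : ℕ) : ℝ) * (2 * a) := mul_le_mul_of_nonneg_left hm (by positivity)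
  have h100 : 100 * ((((P.d + 2) * P.L : ℕ) : ℝ) * (Real.exp ‖t • X‖ - 1)) ≤ ρ := by linarith [hℓ2a]
  have hwin : ‖((avgFun (expMeanLogSU (n := Fin N)) (fun b => (isChartRep_specialUnitaryGroup (n := Fin N)).expChart ((t • X) b) * U₀ b) c *
      (avgFun (expMeanLogSU (n := Fin N)) U₀ c)⁻¹ : SU N) : Matrix (Fin N) (Fin N) ℂ) - 1‖ < innerRadius (specialUnitaryLogChart (Fin N)) := by
    refine (norm_coe_relAvg_sub_one_le U₀ c hρ (hα c) hα4 hρ0 (t • X) h100).trans_lt (lt_of_lt_of_le ?_ hρ)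
    linarith [hℓ2a]
  have hcov := coe_chartRead_gaugeAct h U₀ hj (t • X) c hwin
  show (((fun (A : PBond P j → (specialUnitaryLogChart (Fin N)).lie) (c : PBond P (j + 1)) => (isChartRep_specialUnitaryGroup (n := Fin N)).logChart (avgFun (expMeanLogSU (n := Fin N)) (fun b => (isChartRep_specialUnitaryGroup (n := Fin N)).expChart (A b) * (GaugeField.gaugeAct h U₀) b) c * (avgFun (expMeanLogSU (n := Fin N)) (GaugeField.gaugeAct h U₀) c)⁻¹)) (t • (fun b : PBond P j => (⟨((h b.src : SU N) : Matrix (Fin N) (Fin N) ℂ) * ((X b : (specialUnitaryLogChart (Fin N)).lie) : Matrix (Fin N) (Fin N) ℂ) * star ((h b.src : SU N) : Matrix (Fin N) (Fin N) ℂ), conj_mem_lie (h b.src) (X b)⟩ : (specialUnitaryLogChart (Fin N)).lie))) c : (specialUnitaryLogChart (Fin N)).lie) : Matrix (Fin N) (Fin N) ℂ) = _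
  rw [hsm t]
  exact hcov

/-- ★★★ **DOOR (β′) — THE CHART-READ DERIVATIVE IS GAUGE COVARIANT**: for `U₀` in the loop `α`-guard at every coarse bond (`4α ≤ ρ ≤` inner radius, `0 < ρ`), in the standing range:
`↑((Dψ_{h•U₀}(0)(Ad_h X))(c)) = h(emb c₋)·↑((Dψ_{U₀}(0) X)(c))·h(emb c₋)⋆` — differentiate §2 along the ray `t ↦ t·X` (ray derivatives by ✓`hasDerivAt_chartRead_avgFun_ray` at `U₀` and
at `h•U₀`, whose guard is the same; derivatives of eventually equal curves agree). [cite: Balaban1985Averaging, (11)-(13) p.19, Prop. 3 (122) p.36] -/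
theorem coe_fderiv_chartRead_gaugeAct (hj : j + 1 ≤ P.m + P.K) {α ρ : ℝ} (hρ0 : 0 < ρ) (hρ : ρ ≤ innerRadius (specialUnitaryLogChart (Fin N)))
    (hα : ∀ c i, dist1 (loopHol U₀ c i) ≤ α) (hα4 : 4 * α ≤ ρ) (X : PBond P j → (specialUnitaryLogChart (Fin N)).lie) (c : PBond P (j + 1)) :
    (((fderiv ℝ (fun (A : PBond P j → (specialUnitaryLogChart (Fin N)).lie) (c : PBond P (j + 1)) => (isChartRep_specialUnitaryGroup (n := Fin N)).logChart (avgFun (expMeanLogSU (n := Fin N)) (fun b => (isChartRep_specialUnitaryGroup (n := Fin N)).expChart (A b) * (GaugeField.gaugeAct h U₀) b) c * (avgFun (expMeanLogSU (n := Fin N)) (GaugeField.gaugeAct h U₀) c)⁻¹)) 0 (fun b : PBond P j => (⟨((h b.src : SU N) : Matrix (Fin N) (Fin N) ℂ) * ((X b : (specialUnitaryLogChart (Fin N)).lie) : Matrix (Fin N) (Fin N) ℂ) * star ((h b.src : SU N) : Matrix (Fin N) (Fin N) ℂ), conj_mem_lie (h b.src) (X b)⟩ : (specialUnitaryLogChart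 (Fin N)).lie))) c : (specialUnitaryLogChart (Fin N)).lie) : Matrix (Fin N) (Fin N) ℂ) =
      ((h (emb c.src) : SU N) : Matrix (Fin N) (Fin N) ℂ) * (((fderiv ℝ (fun (A : PBond P j → (specialUnitaryLogChart (Fin N)).lie) (c : PBond P (j + 1)) => (isChartRep_specialUnitaryGroup (n := Fin N)).logChart (avgFun (expMeanLogSU (n := Fin N)) (fun b => (isChartRep_specialUnitaryGroup (n := Fin N)).expChart (A b) * U₀ b) c * (avgFun (expMeanLogSU (n := Fin N)) U₀ c)⁻¹)) 0 X) c : (specialUnitaryLogChart (Fin N)).lie) : Matrix (Fin N) (Fin N) ℂ) * star ((h (emb c.src) : SU N) : Matrix (Fin N) (Fin N) ℂ) := by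
  set Ψ₀ := (fun (A : PBond P j → (specialUnitaryLogChart (Fin N)).lie) (c : PBond P (j + 1)) => (isChartRep_specialUnitaryGroup (n := Fin N)).logChart (avgFun (expMeanLogSU (n := Fin N)) (fun b => (isChartRep_specialUnitaryGroup (n := Fin N)).expChart (A b) * U₀ b) c * (avgFun (expMeanLogSU (n := Fin N)) U₀ c)⁻¹)) with hΨ₀
  set Ψ₁ := (fun (A : PBond P j → (specialUnitaryLogChart (Fin N)).lie) (c : PBond P (j + 1)) => (isChartRep_specialUnitaryGroup (n := Fin N)).logChart (avgFun (expMeanLogSU (n := Fin N)) (fun b => (isChartRep_specialUnitaryGroup (n := Fin N)).expChart (A b) * (GaugeField.gaugeAct h U₀) b) c * (avgFun (expMeanLogSU (n := Fin N)) (GaugeField.gaugeAct h U₀) c)⁻¹)) with hΨ₁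
  set Xh : PBond P j → (specialUnitaryLogChart (Fin N)).lie := (fun b : PBond P j => (⟨((h b.src : SU N) : Matrix (Fin N) (Fin N) ℂ) * ((X b : (specialUnitaryLogChart (Fin N)).lie) : Matrix (Fin N) (Fin N) ℂ) * star ((h b.src : SU N) : Matrix (Fin N) (Fin N) ℂ), conj_mem_lie (h b.src) (X b)⟩ : (specialUnitaryLogChart (Fin N)).lie)) with hXh
  set H : Matrix (Fin N) (Fin N) ℂ := ((h (emb c.src) : SU N) : Matrix (Fin N) (Fin N) ℂ) with hH
  have hαδ : α < deltaSU (Fin N) := by linarith [hρ.trans (innerRadius_le_deltaSU (N := N)), deltaSU_pos (n := Fin N)]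
  have hsmall₀ : ∀ c', Small (expMeanLogSU (n := Fin N)) U₀ c' := fun c' i => lt_of_le_of_lt (hα c' i) hαδ
  have hsmall₁ : ∀ c', Small (expMeanLogSU (n := Fin N)) (GaugeField.gaugeAct h U₀) c' := fun c' i => by
    rw [dist1_loopHol_gaugeAct]; exact hsmall₀ c' i
  -- the two ray derivatives, read at `c` and coerced to matrices
  set L : (specialUnitaryLogChart (Fin N)).lie →L[ℝ] Matrix (Fin N) (Fin N) ℂ := ((specialUnitaryLogChart (Fin N)).lie).subtypeL with hL
  have hray₀ := (hasDerivAt_pi.1 (hasDerivAt_chartRead_avgFun_ray (P := P) (N := N) U₀ hsmall₀ X)) c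
  have hray₁ := (hasDerivAt_pi.1 (hasDerivAt_chartRead_avgFun_ray (P := P) (N := N) (GaugeField.gaugeAct h U₀) hsmall₁ Xh)) c
  have hc₀ : HasDerivAt (fun t : ℝ => ((Ψ₀ (t • X) c : (specialUnitaryLogChart (Fin N)).lie) : Matrix (Fin N) (Fin N) ℂ)) (((fderiv ℝ Ψ₀ 0 X) c : (specialUnitaryLogChart (Fin N)).lie) : Matrix (Fin N) (Fin N) ℂ) 0 :=
    L.hasFDerivAt.comp_hasDerivAt (0 : ℝ) hray₀
  have hc₁ : HasDerivAt (fun t : ℝ => ((Ψ₁ (t • Xh) c : (specialUnitaryLogChart (Fin N)).lie) : Matrix (Fin N) (Fin N) ℂ)) (((fderiv ℝ Ψ₁ 0 Xh) c : (specialUnitaryLogChart (Fin N)).lie) : Matrix (Fin N) (Fin N) ℂ) 0 :=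
    L.hasFDerivAt.comp_hasDerivAt (0 : ℝ) hray₁
  have hg : HasDerivAt (fun t : ℝ => H * ((Ψ₀ (t • X) c : (specialUnitaryLogChart (Fin N)).lie) : Matrix (Fin N) (Fin N) ℂ) * star H) (H * (((fderiv ℝ Ψ₀ 0 X) c : (specialUnitaryLogChart (Fin N)).lie) : Matrix (Fin N) (Fin N) ℂ) * star H) 0 :=
    (hc₀.const_mul H).mul_const (star H)
  have heq := coe_chartRead_ray_gaugeAct_eventuallyEq h U₀ hj hρ0 hρ hα hα4 X c
  exact hc₁.unique (hg.congr_of_eventuallyEq heq)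

/-- ★ **THE DERIVATIVE's NORM IS GAUGE INVARIANT**: `‖↑((Dψ_{h•U₀}(0)(Ad_h X))(c))‖ = ‖↑((Dψ_{U₀}(0)X)(c))‖`. [cite: Balaban1985Averaging, (12)-(13) p.19] -/
theorem norm_coe_fderiv_chartRead_gaugeAct (hj : j + 1 ≤ P.m + P.K) {α ρ : ℝ} (hρ0 : 0 < ρ) (hρ : ρ ≤ innerRadius (specialUnitaryLogChart (Fin N)))
    (hα : ∀ c i, dist1 (loopHol U₀ c i) ≤ α) (hα4 : 4 * α ≤ ρ) (X : PBond P j → (specialUnitaryLogChart (Fin N)).lie) (c : PBond P (j + 1)) :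
    ‖(((fderiv ℝ (fun (A : PBond P j → (specialUnitaryLogChart (Fin N)).lie) (c : PBond P (j + 1)) => (isChartRep_specialUnitaryGroup (n := Fin N)).logChart (avgFun (expMeanLogSU (n := Fin N)) (fun b => (isChartRep_specialUnitaryGroup (n := Fin N)).expChart (A b) * (GaugeField.gaugeAct h U₀) b) c * (avgFun (expMeanLogSU (n := Fin N)) (GaugeField.gaugeAct h U₀) c)⁻¹)) 0 (fun b : PBond P j => (⟨((h b.src : SU N) : Matrix (Fin N) (Fin N) ℂ) * ((X b : (specialUnitaryLogChart (Fin N)).lie) : Matrix (Fin N) (Fin N) ℂ) * star ((h b.src : SU N) : Matrix (Fin N) (Fin N) ℂ), conj_mem_lie (h b.src) (X b)⟩ : (specialUnitaryLogChart (Fin N)).lie))) c : (specialUnitaryLogChart (Fin N)).lie) : Matrix (Fin N) (Fin N) ℂ)‖ =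
      ‖(((fderiv ℝ (fun (A : PBond P j → (specialUnitaryLogChart (Fin N)).lie) (c : PBond P (j + 1)) => (isChartRep_specialUnitaryGroup (n := Fin N)).logChart (avgFun (expMeanLogSU (n := Fin N)) (fun b => (isChartRep_specialUnitaryGroup (n := Fin N)).expChart (A b) * U₀ b) c * (avgFun (expMeanLogSU (n := Fin N)) U₀ c)⁻¹)) 0 X) c : (specialUnitaryLogChart (Fin N)).lie) : Matrix (Fin N) (Fin N) ℂ)‖ := by
  rw [coe_fderiv_chartRead_gaugeAct h U₀ hj hρ0 hρ hα hα4 X c]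
  refine le_antisymm (norm_coe_conj_le _ _) ?_
  set H : Matrix (Fin N) (Fin N) ℂ := ((h (emb c.src) : SU N) : Matrix (Fin N) (Fin N) ℂ) with hH
  set Y : Matrix (Fin N) (Fin N) ℂ := (((fderiv ℝ (fun (A : PBond P j → (specialUnitaryLogChart (Fin N)).lie) (c : PBond P (j + 1)) => (isChartRep_specialUnitaryGroup (n := Fin N)).logChart (avgFun (expMeanLogSU (n := Fin N)) (fun b => (isChartRep_specialUnitaryGroup (n := Fin N)).expChart (A b) * U₀ b) c * (avgFun (expMeanLogSU (n := Fin N)) U₀ c)⁻¹)) 0 X) c : (specialUnitaryLogChart (Fin N)).lie) : Matrix (Fin N) (Fin N) ℂ) with hY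
  have hstar : star H * H = 1 := by
    have e1 := star_coe_mul_coe_mul_SU (h (emb c.src)) (1 : Matrix (Fin N) (Fin N) ℂ); rwa [mul_one] at e1
  have e : (((h (emb c.src))⁻¹ : SU N) : Matrix (Fin N) (Fin N) ℂ) * (H * Y * star H) * star (((h (emb c.src))⁻¹ : SU N) : Matrix (Fin N) (Fin N) ℂ) = Y := by
    rw [coe_inv_SU, star_star]
    calc star H * (H * Y * star H) * H = (star H * H) * Y * (star H * H) := by noncomm_ring
      _ = Y := by rw [hstar, one_mul, mul_one]
  calc ‖Y‖ = ‖(((h (emb c.src))⁻¹ : SU N) : Matrix (Fin N) (Fin N) ℂ) * (H * Y * star H) * star (((h (emb c.src))⁻¹ : SU N) : Matrix (Fin N) (Fin N) ℂ)‖ := by rw [e]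
    _ ≤ ‖H * Y * star H‖ := norm_coe_conj_le _ _

/-- ★★ **THE SECOND-ORDER REMAINDER IS GAUGE INVARIANT IN NORM**: `‖↑(ψ_{h•U₀}(Ad_h X)c) − ↑((Dψ_{h•U₀}(0)(Ad_h X))c)‖ = ‖↑(ψ_{U₀}(X)c) − ↑((Dψ_{U₀}(0)X)c)‖` — so the curved
(β-3)′ (C₂ ✓`norm_chartRead_sub_fderiv_le_curved_osc`) may be applied in ANY gauge copy of the background; with (γ) the oscillation transfers at the price `2·sup‖h − 1‖·M`.
[cite: Balaban1985Averaging, (12)-(13) p.19, Prop. 3 (121)-(123) p.36] -/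
theorem norm_chartRead_sub_fderiv_gaugeAct (hj : j + 1 ≤ P.m + P.K) {α ρ : ℝ} (hρ0 : 0 < ρ) (hρ : ρ ≤ innerRadius (specialUnitaryLogChart (Fin N)))
    (hα : ∀ c i, dist1 (loopHol U₀ c i) ≤ α) (hα4 : 4 * α ≤ ρ) (X : PBond P j → (specialUnitaryLogChart (Fin N)).lie) (c : PBond P (j + 1))
    (hX : 100 * ((((P.d + 2) * P.L : ℕ) : ℝ) * (Real.exp ‖X‖ - 1)) ≤ ρ) :
    ‖((((isChartRep_specialUnitaryGroup (n := Fin N)).logChart (avgFun (expMeanLogSU (n := Fin N)) (fun b => (isChartRep_specialUnitaryGroup (n := Fin N)).expChart ((fun b : PBond P j => (⟨((h b.src : SU N) : Matrix (Fin N) (Fin N) ℂ) * ((X b : (specialUnitaryLogChart (Fin N)).lie) : Matrix (Fin N) (Fin N) ℂ) * star ((h b.src : SU N) : Matrix (Fin N) (Fin N) ℂ), conj_mem_lie (h b.src) (X b)⟩ : (specialUnitaryLogChart (Fin N)).lie)) b) * (GaugeField.gaugeAct h U₀) b) c * (avgFun (expMeanLogSU (n := Fin N)) (GaugeField.gaugeAct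 h U₀) c)⁻¹)) : (specialUnitaryLogChart (Fin N)).lie) : Matrix (Fin N) (Fin N) ℂ) -
        (((fderiv ℝ (fun (A : PBond P j → (specialUnitaryLogChart (Fin N)).lie) (c : PBond P (j + 1)) => (isChartRep_specialUnitaryGroup (n := Fin N)).logChart (avgFun (expMeanLogSU (n := Fin N)) (fun b => (isChartRep_specialUnitaryGroup (n := Fin N)).expChart (A b) * (GaugeField.gaugeAct h U₀) b) c * (avgFun (expMeanLogSU (n := Fin N)) (GaugeField.gaugeAct h U₀) c)⁻¹)) 0 (fun b : PBond P j => (⟨((h b.src : SU N) : Matrix (Fin N) (Fin N) ℂ) * ((X b : (specialUnitaryLogChart (Fin N)).lie) : Matrix (Fin N) (Fin N) ℂ) * star ((h b.src : SU N) : Matrix (Fin N) (Fin N) ℂ), conj_mem_lie (h b.src) (X b)⟩ : (specialUnitaryLogChart (Fin N)).lie))) c : (specialUnitaryLogChart (Fin N)).lie) : Matrix (Fin N) (Fin N) ℂ)‖ =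
      ‖((((isChartRep_specialUnitaryGroup (n := Fin N)).logChart (avgFun (expMeanLogSU (n := Fin N)) (fun b => (isChartRep_specialUnitaryGroup (n := Fin N)).expChart (X b) * U₀ b) c * (avgFun (expMeanLogSU (n := Fin N)) U₀ c)⁻¹)) : (specialUnitaryLogChart (Fin N)).lie) : Matrix (Fin N) (Fin N) ℂ) -
        (((fderiv ℝ (fun (A : PBond P j → (specialUnitaryLogChart (Fin N)).lie) (c : PBond P (j + 1)) => (isChartRep_specialUnitaryGroup (n := Fin N)).logChart (avgFun (expMeanLogSU (n := Fin N)) (fun b => (isChartRep_specialUnitaryGroup (n := Fin N)).expChart (A b) * U₀ b) c * (avgFun (expMeanLogSU (n := Fin N)) U₀ c)⁻¹)) 0 X) c : (specialUnitaryLogChart (Fin N)).lie) : Matrix (Fin N) (Fin N) ℂ)‖ := by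
  have hρ3 : ρ ≤ 1 / 3 := hρ.trans innerRadius_le_third
  have hwin : ‖((avgFun (expMeanLogSU (n := Fin N)) (fun b => (isChartRep_specialUnitaryGroup (n := Fin N)).expChart (X b) * U₀ b) c *
      (avgFun (expMeanLogSU (n := Fin N)) U₀ c)⁻¹ : SU N) : Matrix (Fin N) (Fin N) ℂ) - 1‖ < innerRadius (specialUnitaryLogChart (Fin N)) := by
    refine (norm_coe_relAvg_sub_one_le U₀ c hρ (hα c) hα4 hρ0 X hX).trans_lt (lt_of_lt_of_le ?_ hρ)
    nlinarith
  rw [coe_chartRead_gaugeAct h U₀ hj X c hwin, coe_fderiv_chartRead_gaugeAct h U₀ hj hρ0 hρ hα hα4 X c]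
  set H : Matrix (Fin N) (Fin N) ℂ := ((h (emb c.src) : SU N) : Matrix (Fin N) (Fin N) ℂ) with hH
  set Y : Matrix (Fin N) (Fin N) ℂ := ((((isChartRep_specialUnitaryGroup (n := Fin N)).logChart (avgFun (expMeanLogSU (n := Fin N)) (fun b => (isChartRep_specialUnitaryGroup (n := Fin N)).expChart (X b) * U₀ b) c * (avgFun (expMeanLogSU (n := Fin N)) U₀ c)⁻¹)) : (specialUnitaryLogChart (Fin N)).lie) : Matrix (Fin N) (Fin N) ℂ) -
        (((fderiv ℝ (fun (A : PBond P j → (specialUnitaryLogChart (Fin N)).lie) (c : PBond P (j + 1)) => (isChartRep_specialUnitaryGroup (n := Fin N)).logChart (avgFun (expMeanLogSU (n := Fin N)) (fun b => (isChartRep_specialUnitaryGroup (n := Fin N)).expChart (A b) * U₀ b) c * (avgFun (expMeanLogSU (n := Fin N)) U₀ c)⁻¹)) 0 X) c : (specialUnitaryLogChart (Fin N)).lie) : Matrix (Fin N) (Fin N) ℂ) with hY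
  have hsplit : H * ((((isChartRep_specialUnitaryGroup (n := Fin N)).logChart (avgFun (expMeanLogSU (n := Fin N)) (fun b => (isChartRep_specialUnitaryGroup (n := Fin N)).expChart (X b) * U₀ b) c * (avgFun (expMeanLogSU (n := Fin N)) U₀ c)⁻¹)) : (specialUnitaryLogChart (Fin N)).lie) : Matrix (Fin N) (Fin N) ℂ) * star H -
      H * (((fderiv ℝ (fun (A : PBond P j → (specialUnitaryLogChart (Fin N)).lie) (c : PBond P (j + 1)) => (isChartRep_specialUnitaryGroup (n := Fin N)).logChart (avgFun (expMeanLogSU (n := Fin N)) (fun b => (isChartRep_specialUnitaryGroup (n := Fin N)).expChart (A b) * U₀ b) c * (avgFun (expMeanLogSU (n := Fin N)) U₀ c)⁻¹)) 0 X) c : (specialUnitaryLogChart (Fin N)).lie) : Matrix (Fin N) (Fin N) ℂ) * star H = H * Y * star H := by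
    rw [hY]; noncomm_ring
  rw [hsplit]
  refine le_antisymm (norm_coe_conj_le _ _) ?_
  have hstar : star H * H = 1 := by
    have e1 := star_coe_mul_coe_mul_SU (h (emb c.src)) (1 : Matrix (Fin N) (Fin N) ℂ); rwa [mul_one] at e1
  have e : (((h (emb c.src))⁻¹ : SU N) : Matrix (Fin N) (Fin N) ℂ) * (H * Y * star H) * star (((h (emb c.src))⁻¹ : SU N) : Matrix (Fin N) (Fin N) ℂ) = Y := by
    rw [coe_inv_SU, star_star]
    calc star H * (H * Y * star H) * H = (star H * H) * Y * (star H * H) := by noncomm_ring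
      _ = Y := by rw [hstar, one_mul, mul_one]
  calc ‖Y‖ = ‖(((h (emb c.src))⁻¹ : SU N) : Matrix (Fin N) (Fin N) ℂ) * (H * Y * star H) * star (((h (emb c.src))⁻¹ : SU N) : Matrix (Fin N) (Fin N) ℂ)‖ := by rw [e]
    _ ≤ ‖H * Y * star H‖ := norm_coe_conj_le _ _

end Deriv

end Summit.QuantumFields.YangMills.Theorems.FluctuationComparisonRegPrIntLS2BetaChartReadGaugeCovariance

end
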